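import Summits.AnomalousDissipation.AnomalousDissipation.Theorems.SawtoothPulseCascadeK1LocalisedCascadeTwoToothAnnulusMass
import Summits.AnomalousDissipation.AnomalousDissipation.Theorems.SawtoothPulseCascadeK1LocalisedCascadeNToothOffLobe

/-!
# K1loc explicit start, phase 1: AUTOMATIC WINDOW MASSES OF THE H-FIBRE TWIST («HMassAuto»)

Helper file of the prover lane on the crux `K1LocalisedCascade` (stmt-AnomalousDissipation-19491), route `SawtoothPulseCascade`
(arbiter A24-6 steps (3)–(5): the per-H-fibre certificates of the V/O junk).  For the exact two-tooth chirp `ĝ₀` of lobe `8p` (`p ≥ 1`),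
a window of vertical frequencies `n ∈ [n₁, n₂]` (`n₁ ≥ 1`) or its mirror `[−n₂, −n₁]`, and sources `|q| ≤ Q`, one numeric certificate
`s` with a THREE-WAY side condition decidable by `norm_num` — trivial (`1 ≤ s`), inside the lobe (`…TwoToothAnnulusMass` inside lemmas with
`K₁ = ⌊(n₁−Q−2)/4⌋`, `K₂ = ⌈(n₂+Q+2)/4⌉` and slacks `x, y`), or beyond the lobe (outside lemmas):
* `hmassAuto_pos`, `hmassAuto_neg`: `Σ_{n∈[n₁,n₂]} ‖ĝ₀(n−q)‖² ≤ s²` and the same on `[−n₂,−n₁]`.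
No definitions; nothing about the crux. [cite: Grafakos2014, Prop. 3.1.2 (5), Prop. 3.2.7 (3)] [problem: turb]
-/

-- `Summit.<Summit>.<Problem>`: single-conjunct summit, the duplicate namespace segment is deliberate.
set_option linter.dupNamespace false

noncomputable section

namespace Summit.AnomalousDissipation.AnomalousDissipation.Theorems.SawtoothPulseCascade.K1Window

open MeasureTheory Filter Topology UnitAddTorus Complex AddCircle
open scoped Real
open Literature.Analysis Literature.Analysis.FunctionSpaces Literature.Analysis.FunctionSpaces.Torus Literature.Analysis.FluidPDE
open Literature.Analysis.FluidPDE.ShearStage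
open Literature.Analysis.FluidPDE.SawtoothCascade Literature.Analysis.FluidPDE.SawtoothCascade.CascadeParams
open Summit.AnomalousDissipation.AnomalousDissipation.Theorems.SawtoothPulseCascade.K1Start

/-- A finite window mass of the exact two-tooth chirp is at most `1` (Parseval). [cite: Grafakos2014, Prop. 3.2.7 (3)] -/
theorem sum_window_sq_norm_twoTooth_le_one (p : ℤ) (W : Finset ℤ) (q : ℤ) :
    ∑ n ∈ W, ‖fourierCoeff ((periodic_exactChirpFun 2 (8 * p)).lift) (n - q)‖ ^ 2 ≤ 1 := by
  obtain ⟨hg₀c, hg₀⟩ := continuous_exactChirp_lift 2 (8 * p)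
  have hP := hasSum_sq_norm_fourierCoeff_nTooth hg₀ hg₀c
  rw [← Finset.sum_image (s := W) (g := fun n => n - q) (f := fun m => ‖fourierCoeff _ m‖ ^ 2) (fun a _ b _ h => by simpa using h)]
  exact hP.summable.sum_le_tsum _ (fun m _ => sq_nonneg _) |>.trans hP.tsum_eq.le

/-- **AUTOMATIC WINDOW MASS, positive window**: `p ≥ 1`, `1 ≤ n₁`, sources `|q| ≤ Q`, and numerals `x y s` with
`K₁ = ⌊(n₁−Q−2)/4⌋`, `K₂ = ⌈(n₂+Q+2)/4⌉` satisfying one of: (i) `1 ≤ s`; (ii) inside: `0 ≤ x, 0 ≤ y, K₁ ≤ K₂, 4K₂ < 8p, 0 ≤ n₁−Q−2,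
1/(8p−4K₂) − 1/(8p−4K₁) ≤ x², 1/(8p+4K₁) − 1/(8p+4K₂) ≤ y², 0.3184(x+y) ≤ s`; (iii) outside: `0 ≤ s, K₁ ≤ K₂, 8p < 4K₁,
0.101322(1/(4K₁−8p) − 1/(4K₂−8p)) ≤ s²`: then `Σ_{n∈[n₁,n₂]} ‖ĝ₀(n−q)‖² ≤ s²`. [cite: Grafakos2014, Prop. 3.1.2 (5), Prop. 3.2.7 (3)] -/
theorem hmassAuto_pos {p : ℤ} (hp : 1 ≤ p) {n₁ n₂ : ℤ} {Q : ℕ} {x y s : ℝ}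
    (hnum : (1 ≤ s) ∨
      (0 ≤ x ∧ 0 ≤ y ∧ (n₁ - Q - 2) / 4 ≤ (n₂ + Q + 5) / 4 ∧ 4 * ((n₂ + Q + 5) / 4) < 8 * p ∧ 0 ≤ n₁ - Q - 2 ∧
        1 / (8 * (p : ℝ) - 4 * (((n₂ + Q + 5) / 4 : ℤ) : ℝ)) - 1 / (8 * (p : ℝ) - 4 * (((n₁ - Q - 2) / 4 : ℤ) : ℝ)) ≤ x ^ 2 ∧
        1 / (8 * (p : ℝ) + 4 * (((n₁ - Q - 2) / 4 : ℤ) : ℝ)) - 1 / (8 * (p : ℝ) + 4 * (((n₂ + Q + 5) / 4 : ℤ) : ℝ)) ≤ y ^ 2 ∧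
        0.3184 * (x + y) ≤ s) ∨
      (0 ≤ s ∧ (n₁ - Q - 2) / 4 ≤ (n₂ + Q + 5) / 4 ∧ 8 * p < 4 * ((n₁ - Q - 2) / 4) ∧
        0.101322 * (1 / (4 * (((n₁ - Q - 2) / 4 : ℤ) : ℝ) - 8 * p) - 1 / (4 * (((n₂ + Q + 5) / 4 : ℤ) : ℝ) - 8 * p)) ≤ s ^ 2))
    (q : ℤ) (hq : |q| ≤ Q) :
    ∑ n ∈ Finset.Icc n₁ n₂, ‖fourierCoeff ((periodic_exactChirpFun 2 (8 * p)).lift) (n - q)‖ ^ 2 ≤ s ^ 2 := by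
  classical
  have hπ : 0 < π := Real.pi_pos
  obtain ⟨hg₀c, hg₀⟩ := continuous_exactChirp_lift 2 (8 * p)
  rcases hnum with hs | ⟨hx, hy, hK, hK2, hn1, ha, hb, hs⟩ | ⟨hs0, hK, hK1, hs⟩
  · exact (sum_window_sq_norm_twoTooth_le_one p _ q).trans (by nlinarith)
  · -- inside: reindex and apply the inside lemma with lobe parameter `c = p`
    set K₁ : ℤ := (n₁ - Q - 2) / 4 with hK₁
    set K₂ : ℤ := (n₂ + Q + 5) / 4 with hK₂
    have hK₁0 : 0 ≤ K₁ := by rw [hK₁]; omega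
    have hK₂0 : 0 ≤ K₂ := le_trans hK₁0 hK
    rw [← Finset.sum_image (s := Finset.Icc n₁ n₂) (g := fun n => n - q) (f := fun m => ‖fourierCoeff _ m‖ ^ 2)
      (fun a _ b _ h => by simpa using h)]
    have hpR : (0 : ℝ) < p := by exact_mod_cast (show (0:ℤ) < p by omega)
    have hpabs : (p : ℝ) ≤ |(p : ℝ)| := le_abs_self _
    have hKnat : K₁.toNat ≤ K₂.toNat := by omega
    have hK2R : 4 * (K₂.toNat : ℝ) < 8 * (p : ℝ) := by
      have : 4 * (K₂.toNat : ℤ) < 8 * p := by rw [Int.toNat_of_nonneg hK₂0]; exact hK2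
      exact_mod_cast this
    have e1 : ((K₁.toNat : ℕ) : ℝ) = ((K₁ : ℤ) : ℝ) := by exact_mod_cast Int.toNat_of_nonneg hK₁0
    have e2 : ((K₂.toNat : ℕ) : ℝ) = ((K₂ : ℤ) : ℝ) := by exact_mod_cast Int.toNat_of_nonneg hK₂0
    have ha' : 1 / (8 * (p : ℝ) - 4 * K₂.toNat) - 1 / (8 * (p : ℝ) - 4 * K₁.toNat) ≤ x ^ 2 := by rw [e1, e2]; exact ha
    have hb' : 1 / (8 * (p : ℝ) + 4 * K₁.toNat) - 1 / (8 * (p : ℝ) + 4 * K₂.toNat) ≤ y ^ 2 := by rw [e1, e2]; exact hb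
    have h := sum_window_sq_norm_twoTooth_inside_pos_le p hg₀ hpR hpabs hKnat hK2R hx hy ha' hb'
      ((Finset.Icc n₁ n₂).image (fun n => n - q)) (fun m hm => by
        rw [Finset.mem_image] at hm
        obtain ⟨n, hn, rfl⟩ := hm
        rw [Finset.mem_Icc] at hn
        have := abs_le.1 hq
        constructor
        · have : 4 * (K₁.toNat : ℤ) = 4 * K₁ := by rw [Int.toNat_of_nonneg hK₁0]
          omega
        · have : 4 * (K₂.toNat : ℤ) = 4 * K₂ := by rw [Int.toNat_of_nonneg hK₂0]
          omega)
    refine h.trans ?_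
    have hpi := inv_pi_sq_le
    have hxy : 0 ≤ (x + y) ^ 2 := sq_nonneg _
    have h2 : (0.3184 : ℝ) ^ 2 * (x + y) ^ 2 ≤ s ^ 2 := by
      rw [← mul_pow]; exact pow_le_pow_left₀ (by positivity) hs 2
    nlinarith
  · -- outside
    set K₁ : ℤ := (n₁ - Q - 2) / 4 with hK₁
    set K₂ : ℤ := (n₂ + Q + 5) / 4 with hK₂
    have hK₁0 : 0 ≤ K₁ := by omega
    have hK₂0 : 0 ≤ K₂ := le_trans hK₁0 hK
    rw [← Finset.sum_image (s := Finset.Icc n₁ n₂) (g := fun n => n - q) (f := fun m => ‖fourierCoeff _ m‖ ^ 2)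
      (fun a _ b _ h => by simpa using h)]
    have hp0 : p ≠ 0 := by omega
    have hKnat : K₁.toNat ≤ K₂.toNat := by omega
    have hpabs : |(p : ℝ)| = p := abs_of_pos (by exact_mod_cast (show (0:ℤ) < p by omega))
    have hK1R : 8 * |(p : ℝ)| < 4 * (K₁.toNat : ℝ) := by
      rw [hpabs]
      have : 8 * p < 4 * (K₁.toNat : ℤ) := by rw [Int.toNat_of_nonneg hK₁0]; exact hK1
      exact_mod_cast this
    have e1 : ((K₁.toNat : ℕ) : ℝ) = ((K₁ : ℤ) : ℝ) := by exact_mod_cast Int.toNat_of_nonneg hK₁0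
    have e2 : ((K₂.toNat : ℕ) : ℝ) = ((K₂ : ℤ) : ℝ) := by exact_mod_cast Int.toNat_of_nonneg hK₂0
    have h := sum_window_sq_norm_twoTooth_outside_pos_le p hg₀ hp0 hKnat hK1R
      ((Finset.Icc n₁ n₂).image (fun n => n - q)) (fun m hm => by
        rw [Finset.mem_image] at hm
        obtain ⟨n, hn, rfl⟩ := hm
        rw [Finset.mem_Icc] at hn
        have := abs_le.1 hq
        constructor
        · have : 4 * (K₁.toNat : ℤ) = 4 * K₁ := by rw [Int.toNat_of_nonneg hK₁0]
          omega
        · have : 4 * (K₂.toNat : ℤ) = 4 * K₂ := by rw [Int.toNat_of_nonneg hK₂0]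
          omega)
    rw [hpabs, e1, e2] at h
    refine h.trans ?_
    have hpi := inv_pi_sq_le
    have hd0 : 0 ≤ 1 / (4 * ((K₁ : ℤ) : ℝ) - 8 * p) - 1 / (4 * ((K₂ : ℤ) : ℝ) - 8 * p) := by
      have h1 : (0 : ℝ) < 4 * ((K₁ : ℤ) : ℝ) - 8 * p := by
        have : 8 * p < 4 * K₁ := hK1
        have : (8 * p : ℝ) < 4 * ((K₁ : ℤ) : ℝ) := by exact_mod_cast this
        linarith
      have h2 : 4 * ((K₁ : ℤ) : ℝ) - 8 * p ≤ 4 * ((K₂ : ℤ) : ℝ) - 8 * p := by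
        have : ((K₁ : ℤ) : ℝ) ≤ ((K₂ : ℤ) : ℝ) := by exact_mod_cast hK
        linarith
      have := one_div_le_one_div_of_le h1 h2
      linarith
    nlinarith

/-- **AUTOMATIC WINDOW MASS, mirrored window** `[−n₂, −n₁]`: same hypothesis, same bound. [cite: Grafakos2014, Prop. 3.1.2 (5)] -/
theorem hmassAuto_neg {p : ℤ} (hp : 1 ≤ p) {n₁ n₂ : ℤ} {Q : ℕ} {x y s : ℝ}
    (hnum : (1 ≤ s) ∨
      (0 ≤ x ∧ 0 ≤ y ∧ (n₁ - Q - 2) / 4 ≤ (n₂ + Q + 5) / 4 ∧ 4 * ((n₂ + Q + 5) / 4) < 8 * p ∧ 0 ≤ n₁ - Q - 2 ∧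
        1 / (8 * (p : ℝ) - 4 * (((n₂ + Q + 5) / 4 : ℤ) : ℝ)) - 1 / (8 * (p : ℝ) - 4 * (((n₁ - Q - 2) / 4 : ℤ) : ℝ)) ≤ x ^ 2 ∧
        1 / (8 * (p : ℝ) + 4 * (((n₁ - Q - 2) / 4 : ℤ) : ℝ)) - 1 / (8 * (p : ℝ) + 4 * (((n₂ + Q + 5) / 4 : ℤ) : ℝ)) ≤ y ^ 2 ∧
        0.3184 * (x + y) ≤ s) ∨
      (0 ≤ s ∧ (n₁ - Q - 2) / 4 ≤ (n₂ + Q + 5) / 4 ∧ 8 * p < 4 * ((n₁ - Q - 2) / 4) ∧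
        0.101322 * (1 / (4 * (((n₁ - Q - 2) / 4 : ℤ) : ℝ) - 8 * p) - 1 / (4 * (((n₂ + Q + 5) / 4 : ℤ) : ℝ) - 8 * p)) ≤ s ^ 2))
    (q : ℤ) (hq : |q| ≤ Q) :
    ∑ n ∈ Finset.Icc (-n₂) (-n₁), ‖fourierCoeff ((periodic_exactChirpFun 2 (8 * p)).lift) (n - q)‖ ^ 2 ≤ s ^ 2 := by
  classical
  have hπ : 0 < π := Real.pi_pos
  obtain ⟨hg₀c, hg₀⟩ := continuous_exactChirp_lift 2 (8 * p)
  rcases hnum with hs | ⟨hx, hy, hK, hK2, hn1, ha, hb, hs⟩ | ⟨hs0, hK, hK1, hs⟩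
  · exact (sum_window_sq_norm_twoTooth_le_one p _ q).trans (by nlinarith)
  · set K₁ : ℤ := (n₁ - Q - 2) / 4 with hK₁
    set K₂ : ℤ := (n₂ + Q + 5) / 4 with hK₂
    have hK₁0 : 0 ≤ K₁ := by rw [hK₁]; omega
    have hK₂0 : 0 ≤ K₂ := le_trans hK₁0 hK
    rw [← Finset.sum_image (s := Finset.Icc (-n₂) (-n₁)) (g := fun n => n - q) (f := fun m => ‖fourierCoeff _ m‖ ^ 2)
      (fun a _ b _ h => by simpa using h)]
    have hpR : (0 : ℝ) < p := by exact_mod_cast (show (0:ℤ) < p by omega)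
    have hpabs : (p : ℝ) ≤ |(p : ℝ)| := le_abs_self _
    have hKnat : K₁.toNat ≤ K₂.toNat := by omega
    have hK2R : 4 * (K₂.toNat : ℝ) < 8 * (p : ℝ) := by
      have : 4 * (K₂.toNat : ℤ) < 8 * p := by rw [Int.toNat_of_nonneg hK₂0]; exact hK2
      exact_mod_cast this
    have e1 : ((K₁.toNat : ℕ) : ℝ) = ((K₁ : ℤ) : ℝ) := by exact_mod_cast Int.toNat_of_nonneg hK₁0
    have e2 : ((K₂.toNat : ℕ) : ℝ) = ((K₂ : ℤ) : ℝ) := by exact_mod_cast Int.toNat_of_nonneg hK₂0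
    have ha' : 1 / (8 * (p : ℝ) - 4 * K₂.toNat) - 1 / (8 * (p : ℝ) - 4 * K₁.toNat) ≤ x ^ 2 := by rw [e1, e2]; exact ha
    have hb' : 1 / (8 * (p : ℝ) + 4 * K₁.toNat) - 1 / (8 * (p : ℝ) + 4 * K₂.toNat) ≤ y ^ 2 := by rw [e1, e2]; exact hb
    have h := sum_window_sq_norm_twoTooth_inside_neg_le p hg₀ hpR hpabs hKnat hK2R hx hy ha' hb'
      ((Finset.Icc (-n₂) (-n₁)).image (fun n => n - q)) (fun m hm => by
        rw [Finset.mem_image] at hm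
        obtain ⟨n, hn, rfl⟩ := hm
        rw [Finset.mem_Icc] at hn
        have := abs_le.1 hq
        constructor
        · have : 4 * (K₁.toNat : ℤ) = 4 * K₁ := by rw [Int.toNat_of_nonneg hK₁0]
          omega
        · have : 4 * (K₂.toNat : ℤ) = 4 * K₂ := by rw [Int.toNat_of_nonneg hK₂0]
          omega)
    refine h.trans ?_
    have hpi := inv_pi_sq_le
    have hxy : 0 ≤ (x + y) ^ 2 := sq_nonneg _
    have h2 : (0.3184 : ℝ) ^ 2 * (x + y) ^ 2 ≤ s ^ 2 := by
      rw [← mul_pow]; exact pow_le_pow_left₀ (by positivity) hs 2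
    nlinarith
  · set K₁ : ℤ := (n₁ - Q - 2) / 4 with hK₁
    set K₂ : ℤ := (n₂ + Q + 5) / 4 with hK₂
    have hK₁0 : 0 ≤ K₁ := by omega
    have hK₂0 : 0 ≤ K₂ := le_trans hK₁0 hK
    rw [← Finset.sum_image (s := Finset.Icc (-n₂) (-n₁)) (g := fun n => n - q) (f := fun m => ‖fourierCoeff _ m‖ ^ 2)
      (fun a _ b _ h => by simpa using h)]
    have hp0 : p ≠ 0 := by omega
    have hKnat : K₁.toNat ≤ K₂.toNat := by omega
    have hpabs : |(p : ℝ)| = p := abs_of_pos (by exact_mod_cast (show (0:ℤ) < p by omega))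
    have hK1R : 8 * |(p : ℝ)| < 4 * (K₁.toNat : ℝ) := by
      rw [hpabs]
      have : 8 * p < 4 * (K₁.toNat : ℤ) := by rw [Int.toNat_of_nonneg hK₁0]; exact hK1
      exact_mod_cast this
    have e1 : ((K₁.toNat : ℕ) : ℝ) = ((K₁ : ℤ) : ℝ) := by exact_mod_cast Int.toNat_of_nonneg hK₁0
    have e2 : ((K₂.toNat : ℕ) : ℝ) = ((K₂ : ℤ) : ℝ) := by exact_mod_cast Int.toNat_of_nonneg hK₂0
    have h := sum_window_sq_norm_twoTooth_outside_neg_le p hg₀ hp0 hKnat hK1R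
      ((Finset.Icc (-n₂) (-n₁)).image (fun n => n - q)) (fun m hm => by
        rw [Finset.mem_image] at hm
        obtain ⟨n, hn, rfl⟩ := hm
        rw [Finset.mem_Icc] at hn
        have := abs_le.1 hq
        constructor
        · have : 4 * (K₁.toNat : ℤ) = 4 * K₁ := by rw [Int.toNat_of_nonneg hK₁0]
          omega
        · have : 4 * (K₂.toNat : ℤ) = 4 * K₂ := by rw [Int.toNat_of_nonneg hK₂0]
          omega)
    rw [hpabs, e1, e2] at h
    refine h.trans ?_
    have hpi := inv_pi_sq_le
    have hd0 : 0 ≤ 1 / (4 * ((K₁ : ℤ) : ℝ) - 8 * p) - 1 / (4 * ((K₂ : ℤ) : ℝ) - 8 * p) := by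
      have h1 : (0 : ℝ) < 4 * ((K₁ : ℤ) : ℝ) - 8 * p := by
        have : 8 * p < 4 * K₁ := hK1
        have : (8 * p : ℝ) < 4 * ((K₁ : ℤ) : ℝ) := by exact_mod_cast this
        linarith
      have h2 : 4 * ((K₁ : ℤ) : ℝ) - 8 * p ≤ 4 * ((K₂ : ℤ) : ℝ) - 8 * p := by
        have : ((K₁ : ℤ) : ℝ) ≤ ((K₂ : ℤ) : ℝ) := by exact_mod_cast hK
        linarith
      have := one_div_le_one_div_of_le h1 h2
      linarith
    nlinarith

end Summit.AnomalousDissipation.AnomalousDissipation.Theorems.SawtoothPulseCascade.K1Window
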